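import Summits.BirchSwinnertonDyer.BirchSwinnertonDyer.Theorems.CMKolyvaginAtInertTwoExactSumDefectLeOneAtTwo
import HarnessLib

/-! Scratch (bsd-line-cmk2-p1 g21): kernel check of TURNKEY asides / the RESTATEMENT R1′ for crux 24277 `CMKolyvaginExactAtInertTwo`
(stmt-BirchSwinnertonDyer-24277).  Twin of g19's `TURNKEY_route_edit_24277_lower.lean` (L0 / L0-EXACT on prime `|d_K|`), now on the
crux's WHOLE PROVABLE SUB-HABITAT `Σ ≤ 1` (g20 RESTATE-24277.md option R1′), `Σ` the genus defect of g15/g18 written VERBATIM as in the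
landed files (`KolyvaginPairSupplyTwo.card_primaryComponent_sha_two_baseChange_le_pow_of_sum_defect_le_one`,
`KolyvaginLowerTwo.cmKolyvaginExactAtInertTwo_of_sum_defect_le_one_of_printedInputs`):
  `Σ := ∑ q ∈ (discr K).natAbs.primeFactors, ([jacobiSym Δ.num q = −1] + 2·[jacobiSym Δ.num q = 1 ∧ Even (a_q)])`.
THREE OBJECTS (the pen chooses; nothing here is filed — route verbs are the pen's, D-0059):
(R1′) `CMKolyvaginExactAtInertTwoOneBitRestated` — what 24277 ITSELF would read after the restatement: the crux VERBATIM with ONLY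
      `Σ ≤ 1` inserted after the Heegner hypothesis (the current crux trivially implies it: a hypothesis is added).  Its `…OfFacts` twin takes the four published inputs (items 24148, 19921, 19273,
      24149) AND the named fact `GrossLMS1991.prop37_2_reductionCongruence_inert` at `(N_E, W, K)` — Gross 1991 Prop. 3.7 (2), a
      Literature `def … : Prop` without `_holds` (typer/print debt shared with gk2/KRR) — as antecedents; closer kernel-checked below.
(A1)  `CMKolyvaginExactAtInertTwoOneBit` — ASIDE shape à la g19's L0-EXACT: the crux VERBATIM with `Σ ≤ 1` AND Prop. 3.7 (2) by name
      inserted after the Heegner hypothesis; `…OfFacts` twin on the four prints; closer below.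
(A1L) `CMKolyvaginLowerAtInertTwoOneBit` — the `≥` half in the same shape (for a `stub_lower`-type booking).
(S1′) `CMPrimitiveSupplyAtInertTwoOneBitRestated` — the SUPPLY crux 24276 restated in step (`Σ ≤ 1` conjunct on the supplied `K`);
      NOT closable with the current prints (Hoffstein–Luo gives no Σ control) — names the print the supply then owes; + glue sanity.
For `|d_K|` prime, `Σ = 1` (g15 `ShaCountTwo`, Jacobi reciprocity), so these SUPERSEDE the prime-`|d_K|` asides of TURNKEY v2.
Honest residuals: `Σ ≥ 3` (g20: deep witnesses give `2^(2M₀+Σ−1)` there — the method cannot reach the crux's value); the named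
fact; the four prints.  BSD is not proved by any of this; nothing is closed by name by this scratch. -/

namespace Scratch.CMKolyvaginAtInertTwoEdit24277OneBit

open Summit.BirchSwinnertonDyer.BirchSwinnertonDyer.Theorems

/-! ## (R1′) the restated crux and its `…OfFacts` closer -/

/-- PROPOSED RESTATEMENT R1′ of crux 24277: the crux VERBATIM with `Σ ≤ 1` (one-bit genus defect) inserted after the Heegner hypothesis. -/
def CMKolyvaginExactAtInertTwoOneBitRestated : Prop :=
  ∀ (W : WeierstrassCurve ℚ) [W.IsElliptic] [W.IsGloballyMinimal] [NeZero (W.conductorNorm ℤ)], W.HasCM → Literature.NumberTheory.EllipticCurves.Rank1Residual.CMInert W 2 → W.HasSurjectiveModNGaloisRep (2 : ℤ) → Odd W.tamagawaProduct → ∀ (K : Type) [Field K] [NumberField K], Literature.NumberTheory.EllipticCurves.IsImaginaryQuadratic K → Odd (NumberField.discr K) → NumberField.discr K ≠ -3 → Literature.NumberTheory.EllipticCurves.SatisfiesHeegnerHypothesis (W.conductorNorm ℤ) K → (∑ q ∈ (NumberField.discr K).natAbs.primeFactors, ((if jacobiSym W.Δ.num q = -1 then 1 else 0) + (if jacobiSym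 W.Δ.num q = 1 ∧ Even (W.frobeniusTrace q) then 2 else 0)) ≤ 1) → ¬ IsSquare ((NumberField.discr K : ℚ) * -|W.Δ|) → ¬ IsSquare ((NumberField.discr K : ℚ) * (-(2 * |W.Δ|))) → ∀ (Dt : Literature.NumberTheory.EllipticCurves.ModularForms.ModularParametrizationData W (W.conductorNorm ℤ)) (β : ℤ) (ι : K →+* ℂ) (d₁ : Literature.NumberTheory.EllipticCurves.KolyvaginHeegnerData Dt β ι 1), ¬ IsOfFinAddOrder d₁.derivedPoint → ∀ (M₀ : ℕ), (∃ Q : (W.baseChange (Literature.NumberTheory.EllipticCurves.ringClassField K ι 1)).toAffine.Point, ((2 ^ M₀ : ℕ) : ℤ) • Q = d₁.derivedPoint) → (¬ ∃ Q : (W.baseChange (Literature.NumberTheory.EllipticCurves.ringClassField K ι 1)).toAffine.Point, ((2 ^ (M₀ + 1) : ℕ) : ℤ) • Q = d₁.derivedPoint) → ∀ (n : ℕ) (d : Literature.NumberTheory.EllipticCurves.KolyvaginHeegnerData Dt β ι n), Squarefree n → (∀ ℓ ∈ n.primeFactors, (Literature.NumberTheory.EllipticCurves.Zhang2014.IsKolyvaginPrime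 (W.conductorNorm ℤ) W K 2 ℓ ∧ Literature.NumberTheory.EllipticCurves.Rank1Residual.CMInert W ℓ)) → (¬ ∃ Q : (W.baseChange (Literature.NumberTheory.EllipticCurves.ringClassField K ι n)).toAffine.Point, (2 : ℤ) • Q = d.derivedPoint) → Nat.card (AddCommGroup.primaryComponent (W.baseChange K).sha 2) = 2 ^ (2 * M₀)

/-- `…OfFacts` twin of (R1′): antecedent = the four published inputs ∧ Gross 1991 Prop. 3.7 (2) by name (quantified over the frame,
since the fact is stated per `(N, W, K)`). -/
def CMKolyvaginExactAtInertTwoOneBitRestatedOfFacts : Prop :=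
  (((∀ (N : ℕ) [NeZero N] (W : WeierstrassCurve ℚ) (K : Type) [Field K] [NumberField K],
      Literature.NumberTheory.EllipticCurves.gross_zagier N W K) ∧
    Literature.NumberTheory.EllipticCurves.rank_eq_analyticRank_of_analyticRank_le_one ∧
    WeierstrassCurve.hasEntireLFunction_rat ∧
    Literature.NumberTheory.EllipticCurves.Milne1972.bsdQuotient_baseChange_quadratic_anyModel) ∧
    (∀ (W : WeierstrassCurve ℚ) [W.IsElliptic] [W.IsGloballyMinimal] [NeZero (W.conductorNorm ℤ)] (K : Type) [Field K] [NumberField K],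
      Literature.NumberTheory.EllipticCurves.GrossLMS1991.prop37_2_reductionCongruence_inert (W.conductorNorm ℤ) W K)) →
  CMKolyvaginExactAtInertTwoOneBitRestated

/-- THE CLOSER of (R1′)-OfFacts (kernel-checked here), by `KolyvaginLowerTwo.cmKolyvaginExactAtInertTwo_of_sum_defect_le_one_of_printedInputs`. -/
theorem cmKolyvaginExactAtInertTwoOneBitRestatedOfFacts_proof : CMKolyvaginExactAtInertTwoOneBitRestatedOfFacts := by
  rintro ⟨⟨hGZ, hGZK, hmod, hMi⟩, h37⟩ W _ _ _ hCM hin hρ hT K _ _ hK hodd h3 hH hdef hs1 hs2 Dt β ι d₁ hy M₀ hdiv hndiv n d hn hKoly hPn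
  exact KolyvaginLowerTwo.cmKolyvaginExactAtInertTwo_of_sum_defect_le_one_of_printedInputs W hCM hin hρ hT K hK hodd h3 hH hs1 hs2 Dt β ι
    d₁ hy M₀ hdiv hndiv n d hn hKoly hPn hdef (h37 W K) hGZ hGZK hmod hMi

/-! ## (A1) aside shape: `Σ ≤ 1` and Prop. 3.7 (2) by name inserted; `…OfFacts` on the four prints -/

/-- PROPOSED aside (A1): crux 24277 VERBATIM with `Σ ≤ 1` and Gross 1991 Prop. 3.7 (2) by name inserted after the Heegner hypothesis;
conclusion `=`.  24277 itself on H₂ ∩ {Σ ≤ 1}, modulo the four prints and `prop37_2`. -/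
def CMKolyvaginExactAtInertTwoOneBit : Prop :=
  ∀ (W : WeierstrassCurve ℚ) [W.IsElliptic] [W.IsGloballyMinimal] [NeZero (W.conductorNorm ℤ)], W.HasCM → Literature.NumberTheory.EllipticCurves.Rank1Residual.CMInert W 2 → W.HasSurjectiveModNGaloisRep (2 : ℤ) → Odd W.tamagawaProduct → ∀ (K : Type) [Field K] [NumberField K], Literature.NumberTheory.EllipticCurves.IsImaginaryQuadratic K → Odd (NumberField.discr K) → NumberField.discr K ≠ -3 → Literature.NumberTheory.EllipticCurves.SatisfiesHeegnerHypothesis (W.conductorNorm ℤ) K → (∑ q ∈ (NumberField.discr K).natAbs.primeFactors, ((if jacobiSym W.Δ.num q = -1 then 1 else 0) + (if jacobiSym W.Δ.num q = 1 ∧ Even (W.frobeniusTrace q) then 2 else 0)) ≤ 1) → Literature.NumberTheory.EllipticCurves.GrossLMS1991.prop37_2_reductionCongruence_inert (W.conductorNorm ℤ) W K → ¬ IsSquare ((NumberField.discr K : ℚ) * -|W.Δ|) → ¬ IsSquare ((NumberField.discr K : ℚ) * (-(2 * |W.Δ|))) → ∀ (Dt : Literature.NumberTheory.EllipticCurves.ModularForms.ModularParametrizationData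 W (W.conductorNorm ℤ)) (β : ℤ) (ι : K →+* ℂ) (d₁ : Literature.NumberTheory.EllipticCurves.KolyvaginHeegnerData Dt β ι 1), ¬ IsOfFinAddOrder d₁.derivedPoint → ∀ (M₀ : ℕ), (∃ Q : (W.baseChange (Literature.NumberTheory.EllipticCurves.ringClassField K ι 1)).toAffine.Point, ((2 ^ M₀ : ℕ) : ℤ) • Q = d₁.derivedPoint) → (¬ ∃ Q : (W.baseChange (Literature.NumberTheory.EllipticCurves.ringClassField K ι 1)).toAffine.Point, ((2 ^ (M₀ + 1) : ℕ) : ℤ) • Q = d₁.derivedPoint) → ∀ (n : ℕ) (d : Literature.NumberTheory.EllipticCurves.KolyvaginHeegnerData Dt β ι n), Squarefree n → (∀ ℓ ∈ n.primeFactors, (Literature.NumberTheory.EllipticCurves.Zhang2014.IsKolyvaginPrime (W.conductorNorm ℤ) W K 2 ℓ ∧ Literature.NumberTheory.EllipticCurves.Rank1Residual.CMInert W ℓ)) → (¬ ∃ Q : (W.baseChange (Literature.NumberTheory.EllipticCurves.ringClassField K ι n)).toAffine.Point, (2 : ℤ) • Q = d.derivedPoint) → Nat.card (AddCommGroup.primaryComponent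 (W.baseChange K).sha 2) = 2 ^ (2 * M₀)

/-- `…OfFacts` twin of (A1) on the route's four published inputs (items 24148, 19921, 19273, 24149). -/
def CMKolyvaginExactAtInertTwoOneBitOfFacts : Prop :=
  ((∀ (N : ℕ) [NeZero N] (W : WeierstrassCurve ℚ) (K : Type) [Field K] [NumberField K],
      Literature.NumberTheory.EllipticCurves.gross_zagier N W K) ∧
    Literature.NumberTheory.EllipticCurves.rank_eq_analyticRank_of_analyticRank_le_one ∧
    WeierstrassCurve.hasEntireLFunction_rat ∧
    Literature.NumberTheory.EllipticCurves.Milne1972.bsdQuotient_baseChange_quadratic_anyModel) →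
  CMKolyvaginExactAtInertTwoOneBit

/-- THE CLOSER of (A1)-OfFacts (kernel-checked here). -/
theorem cmKolyvaginExactAtInertTwoOneBitOfFacts_proof : CMKolyvaginExactAtInertTwoOneBitOfFacts := by
  rintro ⟨hGZ, hGZK, hmod, hMi⟩ W _ _ _ hCM hin hρ hT K _ _ hK hodd h3 hH hdef h372 hs1 hs2 Dt β ι d₁ hy M₀ hdiv hndiv n d hn hKoly hPn
  exact KolyvaginLowerTwo.cmKolyvaginExactAtInertTwo_of_sum_defect_le_one_of_printedInputs W hCM hin hρ hT K hK hodd h3 hH hs1 hs2 Dt β ι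
    d₁ hy M₀ hdiv hndiv n d hn hKoly hPn hdef h372 hGZ hGZK hmod hMi

/-- PROPOSED aside (A1L): the `≥` half in the same shape (for a `stub_lower`-type booking). -/
def CMKolyvaginLowerAtInertTwoOneBit : Prop :=
  ∀ (W : WeierstrassCurve ℚ) [W.IsElliptic] [W.IsGloballyMinimal] [NeZero (W.conductorNorm ℤ)], W.HasCM → Literature.NumberTheory.EllipticCurves.Rank1Residual.CMInert W 2 → W.HasSurjectiveModNGaloisRep (2 : ℤ) → Odd W.tamagawaProduct → ∀ (K : Type) [Field K] [NumberField K], Literature.NumberTheory.EllipticCurves.IsImaginaryQuadratic K → Odd (NumberField.discr K) → NumberField.discr K ≠ -3 → Literature.NumberTheory.EllipticCurves.SatisfiesHeegnerHypothesis (W.conductorNorm ℤ) K → (∑ q ∈ (NumberField.discr K).natAbs.primeFactors, ((if jacobiSym W.Δ.num q = -1 then 1 else 0) + (if jacobiSym W.Δ.num q = 1 ∧ Even (W.frobeniusTrace q) then 2 else 0)) ≤ 1) → Literature.NumberTheory.EllipticCurves.GrossLMS1991.prop37_2_reductionCongruence_inert (W.conductorNorm ℤ) W K → ¬ IsSquare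 ((NumberField.discr K : ℚ) * -|W.Δ|) → ¬ IsSquare ((NumberField.discr K : ℚ) * (-(2 * |W.Δ|))) → ∀ (Dt : Literature.NumberTheory.EllipticCurves.ModularForms.ModularParametrizationData W (W.conductorNorm ℤ)) (β : ℤ) (ι : K →+* ℂ) (d₁ : Literature.NumberTheory.EllipticCurves.KolyvaginHeegnerData Dt β ι 1), ¬ IsOfFinAddOrder d₁.derivedPoint → ∀ (M₀ : ℕ), (∃ Q : (W.baseChange (Literature.NumberTheory.EllipticCurves.ringClassField K ι 1)).toAffine.Point, ((2 ^ M₀ : ℕ) : ℤ) • Q = d₁.derivedPoint) → (¬ ∃ Q : (W.baseChange (Literature.NumberTheory.EllipticCurves.ringClassField K ι 1)).toAffine.Point, ((2 ^ (M₀ + 1) : ℕ) : ℤ) • Q = d₁.derivedPoint) → ∀ (n : ℕ) (d : Literature.NumberTheory.EllipticCurves.KolyvaginHeegnerData Dt β ι n), Squarefree n → (∀ ℓ ∈ n.primeFactors, (Literature.NumberTheory.EllipticCurves.Zhang2014.IsKolyvaginPrime (W.conductorNorm ℤ) W K 2 ℓ ∧ Literature.NumberTheory.EllipticCurves.Rank1Residual.CMInert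 W ℓ)) → (¬ ∃ Q : (W.baseChange (Literature.NumberTheory.EllipticCurves.ringClassField K ι n)).toAffine.Point, (2 : ℤ) • Q = d.derivedPoint) → 2 ^ (2 * M₀) ≤ Nat.card (AddCommGroup.primaryComponent (W.baseChange K).sha 2)

/-- `…OfFacts` twin of (A1L). -/
def CMKolyvaginLowerAtInertTwoOneBitOfFacts : Prop :=
  ((∀ (N : ℕ) [NeZero N] (W : WeierstrassCurve ℚ) (K : Type) [Field K] [NumberField K],
      Literature.NumberTheory.EllipticCurves.gross_zagier N W K) ∧
    Literature.NumberTheory.EllipticCurves.rank_eq_analyticRank_of_analyticRank_le_one ∧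
    WeierstrassCurve.hasEntireLFunction_rat ∧
    Literature.NumberTheory.EllipticCurves.Milne1972.bsdQuotient_baseChange_quadratic_anyModel) →
  CMKolyvaginLowerAtInertTwoOneBit

/-- THE CLOSER of (A1L)-OfFacts (kernel-checked here), by `KolyvaginLowerTwo.stub_lower_of_sum_defect_le_one_of_printedInputs`. -/
theorem cmKolyvaginLowerAtInertTwoOneBitOfFacts_proof : CMKolyvaginLowerAtInertTwoOneBitOfFacts := by
  rintro ⟨hGZ, hGZK, hmod, hMi⟩ W _ _ _ hCM hin hρ hT K _ _ hK hodd h3 hH hdef h372 hs1 hs2 Dt β ι d₁ hy M₀ hdiv hndiv n d hn hKoly hPn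
  exact KolyvaginLowerTwo.stub_lower_of_sum_defect_le_one_of_printedInputs W hCM hin hρ hT K hK hodd h3 hH hs1 hs2 Dt β ι d₁ hy M₀ hdiv
    hndiv n d hn hKoly hPn hdef h372 hGZ hGZK hmod hMi


/-! ## (S1′) the supply crux 24276 restated in step with (R1′), and the glue sanity check -/

/-- PROPOSED RESTATEMENT of the SUPPLY crux 24276 `CMPrimitiveSupplyAtInertTwo` in step with (R1′): VERBATIM with the conjunct `Σ ≤ 1`
inserted after the Heegner hypothesis of the supplied field `K`.  NOT closable with the route's current prints: the landed supply closer
(24649, `CMSupply.cmPrimitiveSupplyAtInertTwo_of_kolyvaginConjectureAtTwo`) takes `K` from Hoffstein–Luo (`≤ 4` prime factors, no control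
of `Σ`).  A PRIME-TWIST non-vanishing print with the Heegner splitting («there is a prime `q ≠ 3`, `q ≡ 3 (mod 4)`, every `p ∣ N_E` split in
`ℚ(√−q)`, with `L(E^(−q), 1) ≠ 0`»; for prime `|d_K|` one has `Σ = 1` on `Δ < 0`, g15) would close it along the same proof
(candidates, unread here: Ono–Skinner 1998, Ono 2001, Kriz–Li 2019 FMS under (★), Chida–Wakatsuki 2026). -/
def CMPrimitiveSupplyAtInertTwoOneBitRestated : Prop :=
  ∀ (W : WeierstrassCurve ℚ) [W.IsElliptic] [W.IsGloballyMinimal] [NeZero (W.conductorNorm ℤ)], W.HasCM → Literature.NumberTheory.EllipticCurves.Rank1Residual.CMInert W 2 → W.HasSurjectiveModNGaloisRep (2 : ℤ) → W.analyticRank = 1 → Odd W.tamagawaProduct → (∃ Dt : Literature.NumberTheory.EllipticCurves.ModularForms.ModularParametrizationData W (W.conductorNorm ℤ), (∀ z ∈ Dt.L.lattice, ∃ w ∈ Literature.NumberTheory.EllipticCurves.ModularForms.periodLattice Dt.f, z = (Dt.c : ℂ) * w) ∧ Odd Dt.c) → ∃ (K : Type) (_ : Field K) (_ : NumberField K), Literature.NumberTheory.EllipticCurves.IsImaginaryQuadratic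 K ∧ Odd (NumberField.discr K) ∧ NumberField.discr K ≠ -3 ∧ Literature.NumberTheory.EllipticCurves.SatisfiesHeegnerHypothesis (W.conductorNorm ℤ) K ∧ (∑ q ∈ (NumberField.discr K).natAbs.primeFactors, ((if jacobiSym W.Δ.num q = -1 then 1 else 0) + (if jacobiSym W.Δ.num q = 1 ∧ Even (W.frobeniusTrace q) then 2 else 0)) ≤ 1) ∧ ¬ IsSquare ((NumberField.discr K : ℚ) * -|W.Δ|) ∧ ¬ IsSquare ((NumberField.discr K : ℚ) * (-(2 * |W.Δ|))) ∧ ∃ (Dt : Literature.NumberTheory.EllipticCurves.ModularForms.ModularParametrizationData W (W.conductorNorm ℤ)) (β : ℤ) (ι : K →+* ℂ) (d₁ : Literature.NumberTheory.EllipticCurves.KolyvaginHeegnerData Dt β ι 1), (∀ z ∈ Dt.L.lattice, ∃ w ∈ Literature.NumberTheory.EllipticCurves.ModularForms.periodLattice Dt.f, z = (Dt.c : ℂ) * w) ∧ Odd Dt.c ∧ ¬ IsOfFinAddOrder d₁.derivedPoint ∧ ∃ M₀ : ℕ, (∃ Q : (W.baseChange (Literature.NumberTheory.EllipticCurves.ringClassField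 K ι 1)).toAffine.Point, ((2 ^ M₀ : ℕ) : ℤ) • Q = d₁.derivedPoint) ∧ (¬ ∃ Q : (W.baseChange (Literature.NumberTheory.EllipticCurves.ringClassField K ι 1)).toAffine.Point, ((2 ^ (M₀ + 1) : ℕ) : ℤ) • Q = d₁.derivedPoint) ∧ ∃ (n : ℕ) (d : Literature.NumberTheory.EllipticCurves.KolyvaginHeegnerData Dt β ι n), Squarefree n ∧ (∀ ℓ ∈ n.primeFactors, (Literature.NumberTheory.EllipticCurves.Zhang2014.IsKolyvaginPrime (W.conductorNorm ℤ) W K 2 ℓ ∧ Literature.NumberTheory.EllipticCurves.Rank1Residual.CMInert W ℓ)) ∧ (¬ ∃ Q : (W.baseChange (Literature.NumberTheory.EllipticCurves.ringClassField K ι n)).toAffine.Point, (2 : ℤ) • Q = d.derivedPoint) ∧ ∃ (Wd : WeierstrassCurve ℚ) (_ : Wd.IsElliptic) (_ : Wd.IsGloballyMinimal), (∃ C : WeierstrassCurve.VariableChange ℚ, C • W.quadraticTwist (NumberField.discr K : ℚ) = Wd) ∧ Wd.HasCM ∧ Wd.analyticRank = 0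

/-- GLUE SANITY: the restated supply (S1′) and the restated exactness (R1′) compose exactly as `closes` composes 24276 and 24277 today
(the `Σ ≤ 1` conjunct of the supplied field feeds the new hypothesis of the exactness crux); output = the exactness conclusion at the
supplied frame together with the rank-`0` CM twin, i.e. what `CMExactDescentAtTwo` + `bsdp_cm_rankZero` consume in `closes`. -/
theorem exact_at_supplied_field_of_restated (hP : CMPrimitiveSupplyAtInertTwoOneBitRestated) (hX : CMKolyvaginExactAtInertTwoOneBitRestated)
    (W : WeierstrassCurve ℚ) [W.IsElliptic] [W.IsGloballyMinimal] [NeZero (W.conductorNorm ℤ)] (hcm : W.HasCM)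
    (hin : Literature.NumberTheory.EllipticCurves.Rank1Residual.CMInert W 2) (hρ : W.HasSurjectiveModNGaloisRep (2 : ℤ))
    (hr : W.analyticRank = 1) (hT : Odd W.tamagawaProduct)
    (hopt : ∃ Dt : Literature.NumberTheory.EllipticCurves.ModularForms.ModularParametrizationData W (W.conductorNorm ℤ),
      (∀ z ∈ Dt.L.lattice, ∃ w ∈ Literature.NumberTheory.EllipticCurves.ModularForms.periodLattice Dt.f, z = (Dt.c : ℂ) * w) ∧ Odd Dt.c) :
    ∃ (K : Type) (_ : Field K) (_ : NumberField K) (Dt : Literature.NumberTheory.EllipticCurves.ModularForms.ModularParametrizationData W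
      (W.conductorNorm ℤ)) (β : ℤ) (ι : K →+* ℂ) (d₁ : Literature.NumberTheory.EllipticCurves.KolyvaginHeegnerData Dt β ι 1) (M₀ : ℕ)
      (Wd : WeierstrassCurve ℚ) (_ : Wd.IsElliptic) (_ : Wd.IsGloballyMinimal),
      Literature.NumberTheory.EllipticCurves.IsImaginaryQuadratic K ∧ Odd (NumberField.discr K) ∧ NumberField.discr K ≠ -3 ∧
      Literature.NumberTheory.EllipticCurves.SatisfiesHeegnerHypothesis (W.conductorNorm ℤ) K ∧
      (∀ z ∈ Dt.L.lattice, ∃ w ∈ Literature.NumberTheory.EllipticCurves.ModularForms.periodLattice Dt.f, z = (Dt.c : ℂ) * w) ∧ Odd Dt.c ∧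
      ¬ IsOfFinAddOrder d₁.derivedPoint ∧
      (∃ Q : (W.baseChange (Literature.NumberTheory.EllipticCurves.ringClassField K ι 1)).toAffine.Point, ((2 ^ M₀ : ℕ) : ℤ) • Q = d₁.derivedPoint) ∧
      (¬ ∃ Q : (W.baseChange (Literature.NumberTheory.EllipticCurves.ringClassField K ι 1)).toAffine.Point,
        ((2 ^ (M₀ + 1) : ℕ) : ℤ) • Q = d₁.derivedPoint) ∧
      Nat.card (AddCommGroup.primaryComponent (W.baseChange K).sha 2) = 2 ^ (2 * M₀) ∧
      (∃ C : WeierstrassCurve.VariableChange ℚ, C • W.quadraticTwist (NumberField.discr K : ℚ) = Wd) ∧ Wd.HasCM ∧ Wd.analyticRank = 0 := by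
  obtain ⟨K, _, _, hIQ, hodd, h3, hHe, hdef, hsq1, hsq2, Dt, β, ι, d₁, hoptDt, hc, hy, M₀, hdiv, hndiv, n, d, hn, hKoly, hPn, Wd, _, _, hWd,
    hcmd, hrd⟩ := hP W hcm hin hρ hr hT hopt
  have hex := hX W hcm hin hρ hT K hIQ hodd h3 hHe hdef hsq1 hsq2 Dt β ι d₁ hy M₀ hdiv hndiv n d hn hKoly hPn
  exact ⟨K, _, _, Dt, β, ι, d₁, M₀, Wd, ‹_›, ‹_›, hIQ, hodd, h3, hHe, hoptDt, hc, hy, hdiv, hndiv, hex, hWd, hcmd, hrd⟩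

end Scratch.CMKolyvaginAtInertTwoEdit24277OneBit
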